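import Literature.Probability.Percolation.QuadCrossingContinuityEventsDischarge
import Literature.Probability.Percolation.QuadCrossingSubseqLimits
import Summits.CriticalPhenomena.CardyFormulaZ2.Theorems.CardySelfRefinementLagHandOffTranslation
import Summits.CriticalPhenomena.CardyFormulaZ2.Theorems.CardyMeckeFlipLawToCrossingsQuads
import HarnessLib

/-!
# Stub S3e `stub_selfDualMarginals_of` of crux `Z2LimitsSymmetric`: the duality assembly

Crux `Z2LimitsSymmetric` (stmt-CriticalPhenomena-14827) of route `CardyMeckeFlip`, sub-problem
`CardyFormulaZ2`, line `registered` (`Cruxes/Z2LimitsSymmetric/Lines/birth.lean`, reshape 1).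

Clause (D) of the crux — exact self-duality of the finite-dimensional crossing marginals of every
subsequential quad-crossing scaling limit `μ ∈ Λ = subseqQuadLimits univ` of critical bond percolation
on `δℤ²`: for quads `Q_i` and transposes `Qt_i` (same carrier, sides advanced by one),
`μ {S | {i | Q_i ∈ S} ∈ A} = μ {S | {i | Qt_i ∉ S} ∈ A}` — is reduced here to three inputs, each a
registered stub of the line proved in its own file:

* (S3a, `stub_dualExclusion`) lattice-level EXCLUSION: at mesh `δ > 0`, if `Q ∈ S_ω` then the
  transposed quad is not crossed by the true dual picture
  `S'_ω = translate ((δ/2)(1+i)) (S_{dualConfig ω})`;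
* (S3b, `stub_oneQuadDualityGe`) the `≥` half of one-quad duality in the limit for charted quads:
  `1 ≤ μ(⊞_{rectQuad H 1 1}) + μ(⊞_{rectQuad (rotI.trans H) 1 1})`;
* (S3d, `stub_crossedEvent_eq_of_sides`) `⊞_Q` depends only on the carrier and the four sides.

**The argument (a coupling / total-variation estimate; GPS13 §2.3, SS11 §1.1 for the statement).**
At mesh `δ` let `ω ∼ P_{1/2}`, `X = {i | Q_i ∈ S_ω}`, `Y = {i | Qt_i ∉ S'_ω}`.  The law of `S_ω` is
`μ_δ = z2QuadLaw univ δ`, the law of `S'_ω` is `ν_δ = (translate ((δ/2)(1+i)))_* μ_δ` because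
`dualConfig_* P_{1/2} = P_{1/2}` (`bondPercolation_map_dualConfig_holds`).  By (S3a) `X ⊆ Y`
pointwise, hence `|μ_δ(E_A) - ν_δ(F_A)| ≤ P[X ≠ Y] ≤ Σ_i (P[i ∈ Y] - P[i ∈ X])
= Σ_i (1 - ν_δ(⊞_{Qt_i}) - μ_δ(⊞_{Q_i}))` (`coupling_le`).  Along the defining meshes `δ_k → 0⁺`
of `μ`: `μ_{δ_k} → μ`, `ν_{δ_k} → μ` (`tendsto_map_translate_of_tendsto`, the shifts tend to `0`),
and every event in the Boolean algebra of finitely many crossing events is a `μ`-continuity set by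
Schramm–Smirnov's Lemma 5.1 (`SchrammSmirnov2011_lemma_5_1_holds`, PROVED in the tree) and Cor. 5.2
(`tendsto_measure_of_null_frontier_generateFrom`); so in the limit
`|μ(E_A) - μ(F_A)| ≤ Σ_i (1 - μ(⊞_{Qt_i}) - μ(⊞_{Q_i})) ≤ 0`, the last step by (S3b) after charting
`Q_i = rectQuad H_i 1 1` (`Quad.exists_homeomorph_extend`) and (S3d) (`⊞_{Qt_i} = ⊞_{Q_i†}` for the
chart transpose `Q_i† = rectQuad (rotI.trans H_i) 1 1`, which has the same carrier and sides as `Qt_i`).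

## References

* [SchrammSmirnov2011] O. Schramm, S. Smirnov, Ann. Probab. 39 (2011) 1768–1814, §1.1, Lemma 5.1,
  Cor. 5.2.
* [GarbanPeteSchramm2013Pivotal] C. Garban, G. Pete, O. Schramm, J. Amer. Math. Soc. 26 (2013),
  arXiv:1008.1378, §2.3 (duality of crossing events in the scaling limit).
* [GrimmettPercolation1999] G. Grimmett, *Percolation*, 2nd ed., §11.2 (planar duality at `p = 1/2`).
-/

noncomputable section

open MeasureTheory Filter Set Topology
open scoped ENNReal NNReal unitInterval
open Literature.Probability.Percolation Literature.Probability.Percolation.QuadCrossing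
open Literature.Probability.LatticeModels
open Summit.CriticalPhenomena.CardyFormulaZ2.Theorems.MeckeFlipBridge

namespace Summit.CriticalPhenomena.CardyFormulaZ2.Cruxes.Z2LimitsSymmetric

/-! ### Cylinder (pattern) events of finitely many quads -/

/-- The pattern event `{S | {i | Q_i ∈ S} ∈ B}` in disjunctive normal form: a union over the
patterns `T ∈ B` of the atoms `⋂_i {S | Q_i ∈ S ↔ i ∈ T}`. -/
theorem setOf_pattern_mem_eq {n : ℕ} (Qs : Fin n → Quad (univ : Set ℂ)) (B : Set (Set (Fin n))) :
    {S : QuadConfig (univ : Set ℂ) | {i | Qs i ∈ S} ∈ B} =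
      ⋃ T ∈ B, ⋂ i, {S : QuadConfig (univ : Set ℂ) | Qs i ∈ S ↔ i ∈ T} := by
  ext S
  simp only [mem_setOf_eq, mem_iUnion, mem_iInter, exists_prop]
  constructor
  · intro h
    exact ⟨_, h, fun i => Iff.rfl⟩
  · rintro ⟨T, hT, h⟩
    have : {i | Qs i ∈ S} = T := Set.ext fun i => h i
    rwa [this]

/-- Pattern events are measurable for the `σ`-algebra generated by the crossing events of any set
of quads containing the `Q_i`. -/
theorem measurableSet_generateFrom_pattern {n : ℕ} (Qs : Fin n → Quad (univ : Set ℂ))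
    (B : Set (Set (Fin n))) {F : Set (Quad (univ : Set ℂ))} (hF : ∀ i, Qs i ∈ F) :
    MeasurableSet[MeasurableSpace.generateFrom ((fun Q => QuadConfig.crossedEvent Q) '' F)]
      {S : QuadConfig (univ : Set ℂ) | {i | Qs i ∈ S} ∈ B} := by
  rw [setOf_pattern_mem_eq]
  refine MeasurableSet.biUnion B.to_countable fun T _ => MeasurableSet.iInter fun i => ?_
  have hgen : MeasurableSet[MeasurableSpace.generateFrom ((fun Q => QuadConfig.crossedEvent Q) '' F)]
      (QuadConfig.crossedEvent (Qs i)) :=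
    MeasurableSpace.measurableSet_generateFrom (mem_image_of_mem _ (hF i))
  by_cases hi : i ∈ T
  · have : {S : QuadConfig (univ : Set ℂ) | Qs i ∈ S ↔ i ∈ T} = QuadConfig.crossedEvent (Qs i) := by
      ext S; simp [hi]
    rw [this]
    exact hgen
  · have : {S : QuadConfig (univ : Set ℂ) | Qs i ∈ S ↔ i ∈ T} = (QuadConfig.crossedEvent (Qs i))ᶜ := by
      ext S; simp [hi]
    rw [this]
    exact hgen.compl

/-- Pattern events are Borel events of `ℋ_ℂ`. -/
theorem measurableSet_pattern {n : ℕ} (Qs : Fin n → Quad (univ : Set ℂ)) (B : Set (Set (Fin n))) :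
    MeasurableSet {S : QuadConfig (univ : Set ℂ) | {i | Qs i ∈ S} ∈ B} := by
  have h := measurableSet_generateFrom_pattern Qs B (F := Set.range Qs) (fun i => mem_range_self i)
  refine MeasurableSpace.generateFrom_le (fun s hs => ?_) _ h
  obtain ⟨Q, -, rfl⟩ := hs
  exact QuadConfig.measurableSet_crossedEvent Q

/-- The complementary pattern event `{S | {i | Q_i ∉ S} ∈ B}` is the pattern event of the
complemented patterns. -/
theorem setOf_pattern_not_mem_eq {n : ℕ} (Qs : Fin n → Quad (univ : Set ℂ)) (B : Set (Set (Fin n))) :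
    {S : QuadConfig (univ : Set ℂ) | {i | Qs i ∉ S} ∈ B} =
      {S : QuadConfig (univ : Set ℂ) | {i | Qs i ∈ S} ∈ compl ⁻¹' B} := by
  ext S
  simp only [mem_setOf_eq, mem_preimage]
  have : {i | Qs i ∉ S} = {i | Qs i ∈ S}ᶜ := rfl
  rw [this]

/-! ### Convergence of pattern events and crossing events along weak limits (Lemma 5.1 + Cor. 5.2) -/

/-- **Cor. 5.2 for pattern events**: if `μs k → μ` weakly and `μ` is a subsequential scaling limit,
then `μs k {S | {i | Q_i ∈ S} ∈ B} → μ {S | {i | Q_i ∈ S} ∈ B}` (every crossing event is a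
`μ`-continuity set by Lemma 5.1, proved in the tree). -/
theorem tendsto_measure_pattern {n : ℕ} (Qs : Fin n → Quad (univ : Set ℂ)) (B : Set (Set (Fin n)))
    {μ : FiniteMeasure (QuadConfig (univ : Set ℂ))} (hμ : IsSubseqQuadLimit univ μ)
    {μs : ℕ → FiniteMeasure (QuadConfig (univ : Set ℂ))} (hlim : Tendsto μs atTop (𝓝 μ)) :
    Tendsto (fun k => (μs k : Measure (QuadConfig (univ : Set ℂ)))
        {S : QuadConfig (univ : Set ℂ) | {i | Qs i ∈ S} ∈ B}) atTop
      (𝓝 ((μ : Measure (QuadConfig (univ : Set ℂ))) {S : QuadConfig (univ : Set ℂ) | {i | Qs i ∈ S} ∈ B})) :=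
  tendsto_measure_of_null_frontier_generateFrom isOpen_univ univ_nonempty hlim (finite_range Qs)
    (fun Q _ => SchrammSmirnov2011_lemma_5_1_holds univ isOpen_univ univ_nonempty μ hμ Q)
    (measurableSet_generateFrom_pattern Qs B (fun i => mem_range_self i))

/-- **Cor. 5.2 for a single crossing event**: `μs k ⊞_Q → μ ⊞_Q`. -/
theorem tendsto_measure_crossedEvent (Q : Quad (univ : Set ℂ))
    {μ : FiniteMeasure (QuadConfig (univ : Set ℂ))} (hμ : IsSubseqQuadLimit univ μ)
    {μs : ℕ → FiniteMeasure (QuadConfig (univ : Set ℂ))} (hlim : Tendsto μs atTop (𝓝 μ)) :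
    Tendsto (fun k => (μs k : Measure (QuadConfig (univ : Set ℂ))) (QuadConfig.crossedEvent Q)) atTop
      (𝓝 ((μ : Measure (QuadConfig (univ : Set ℂ))) (QuadConfig.crossedEvent Q))) :=
  tendsto_measure_of_null_frontier_generateFrom isOpen_univ univ_nonempty hlim (finite_singleton Q)
    (fun Q' _ => SchrammSmirnov2011_lemma_5_1_holds univ isOpen_univ univ_nonempty μ hμ Q')
    (MeasurableSpace.measurableSet_generateFrom ⟨Q, mem_singleton Q, rfl⟩)

/-! ### The coupling at a fixed mesh -/

/-- **The dual picture has the translated law.**  For `δ > 0`, a Borel set `B ⊆ ℋ_ℂ` and a shift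
`v`, the `P_{1/2}`-probability that the shifted configuration of the dual configuration lies in `B`
is `((translate v)_* μ_δ)(B)`: `dualConfig` preserves `P_{1/2}`
(`bondPercolation_map_dualConfig_holds`). -/
theorem prob_dual_translate_eq {δ : ℝ} (hδ : 0 < δ) (v : ℂ) {B : Set (QuadConfig (univ : Set ℂ))}
    (hB : MeasurableSet B) :
    bondPercolation (zdGraph 2) half
        ((QuadConfig.translate v ∘ z2QuadConfig univ δ ∘ dualConfig) ⁻¹' B) =
      (((z2QuadLaw (univ : Set ℂ) δ).map (QuadConfig.translate v) :
          FiniteMeasure (QuadConfig (univ : Set ℂ))) : Measure (QuadConfig (univ : Set ℂ))) B := by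
  have hf : Measurable (z2QuadConfig (univ : Set ℂ) δ) := measurable_z2QuadConfig isOpen_univ hδ
  have ht : Measurable (QuadConfig.translate v) := QuadConfig.measurable_translate v
  have hsymm : unitInterval.symm half = half := Subtype.ext (by simp [half]; norm_num)
  have hpre : MeasurableSet ((QuadConfig.translate v ∘ z2QuadConfig univ δ) ⁻¹' B) := (ht.comp hf) hB
  rw [FiniteMeasure.toMeasure_map, Measure.map_apply ht hB, z2QuadLaw_apply isOpen_univ hδ (ht hB),
    show (QuadConfig.translate v ∘ z2QuadConfig univ δ ∘ dualConfig) ⁻¹' B =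
      dualConfig ⁻¹' ((QuadConfig.translate v ∘ z2QuadConfig univ δ) ⁻¹' B) from rfl,
    ← Measure.map_apply measurable_dualConfig hpre, bondPercolation_map_dualConfig_holds half, hsymm]
  rfl

/-- **The coupling inequality at mesh `δ`.**  Write `C_i = {ω | Q_i ∈ S_ω}`,
`D_i = {ω | Qt_i ∉ S'_ω}` (with `S'_ω` the shifted dual picture); if `C_i ⊆ D_i` for all `i`
(exclusion), then for every set of patterns `A`,
`P{X ∈ A} ≤ P{Y ∈ A} + Σ_i (P D_i - P C_i)` and symmetrically, where `X = {i | ω ∈ C_i}`,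
`Y = {i | ω ∈ D_i}`: on `{X ∈ A} \ {Y ∈ A}` one has `X ≠ Y`, `X ⊆ Y`, so some `i ∈ Y \ X`.
Stated for an arbitrary probability space and arbitrary events. -/
theorem measureReal_pattern_le_of_subset {Ω : Type*} [MeasurableSpace Ω] (P : Measure Ω)
    [IsFiniteMeasure P] {n : ℕ} {C D : Fin n → Set Ω} (hC : ∀ i, MeasurableSet (C i))
    (hCD : ∀ i, C i ⊆ D i) (A : Set (Set (Fin n))) :
    P.real {ω | {i | ω ∈ C i} ∈ A} ≤
        P.real {ω | {i | ω ∈ D i} ∈ A} + ∑ i, (P.real (D i) - P.real (C i)) ∧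
      P.real {ω | {i | ω ∈ D i} ∈ A} ≤
        P.real {ω | {i | ω ∈ C i} ∈ A} + ∑ i, (P.real (D i) - P.real (C i)) := by
  -- where the two patterns differ, some `i` is in `D i \ C i`
  have hdiff : ∀ ω, {i | ω ∈ C i} ≠ {i | ω ∈ D i} → ω ∈ ⋃ i, (D i \ C i) := by
    intro ω hne
    by_contra hno
    apply hne
    ext i
    simp only [mem_setOf_eq]
    refine ⟨fun h => hCD i h, fun h => ?_⟩
    by_contra hc
    exact hno (mem_iUnion.2 ⟨i, h, hc⟩)
  have hsum : P.real (⋃ i, (D i \ C i)) ≤ ∑ i, (P.real (D i) - P.real (C i)) := by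
    refine (measureReal_iUnion_fintype_le _).trans (Finset.sum_le_sum fun i _ => ?_)
    rw [measureReal_sdiff (hCD i) (hC i)]
  constructor
  · calc P.real {ω | {i | ω ∈ C i} ∈ A}
        ≤ P.real ({ω | {i | ω ∈ D i} ∈ A} ∪ ⋃ i, (D i \ C i)) := by
          refine measureReal_mono fun ω hω => ?_
          by_cases h : {i | ω ∈ D i} ∈ A
          · exact Or.inl h
          · refine Or.inr (hdiff ω fun heq => h ?_)
            rw [← heq]; exact hω
      _ ≤ P.real {ω | {i | ω ∈ D i} ∈ A} + P.real (⋃ i, (D i \ C i)) := measureReal_union_le _ _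
      _ ≤ _ := by linarith
  · calc P.real {ω | {i | ω ∈ D i} ∈ A}
        ≤ P.real ({ω | {i | ω ∈ C i} ∈ A} ∪ ⋃ i, (D i \ C i)) := by
          refine measureReal_mono fun ω hω => ?_
          by_cases h : {i | ω ∈ C i} ∈ A
          · exact Or.inl h
          · refine Or.inr (hdiff ω fun heq => h ?_)
            rw [heq]; exact hω
      _ ≤ P.real {ω | {i | ω ∈ C i} ∈ A} + P.real (⋃ i, (D i \ C i)) := measureReal_union_le _ _
      _ ≤ _ := by linarith

/-- **The coupling estimate in terms of the laws `μ_δ` and `ν_δ = (translate v_δ)_* μ_δ`**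
(`v_δ = (δ/2)(1+i)`), given lattice-level exclusion for the pairs `(Q_i, Qt_i)`: for every `A`,
`|μ_δ {S | {i | Q_i ∈ S} ∈ A} - ν_δ {S | {i | Qt_i ∉ S} ∈ A}| ≤ Σ_i (1 - ν_δ ⊞_{Qt_i} - μ_δ ⊞_{Q_i})`
(both one-sided inequalities). -/
theorem coupling_le {δ : ℝ} (hδ : 0 < δ) {n : ℕ} (Q Qt : Fin n → Quad (univ : Set ℂ))
    (hexcl : ∀ (ω : BondConfig (Site 2)) (i : Fin n), Q i ∈ z2QuadConfig (univ : Set ℂ) δ ω →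
      Qt i ∉ QuadConfig.translate (((δ / 2 : ℝ) : ℂ) * (1 + Complex.I))
        (z2QuadConfig (univ : Set ℂ) δ (dualConfig ω)))
    (A : Set (Set (Fin n))) :
    let μδ : Measure (QuadConfig (univ : Set ℂ)) := (z2QuadLaw (univ : Set ℂ) δ : FiniteMeasure _)
    let νδ : Measure (QuadConfig (univ : Set ℂ)) :=
      ((z2QuadLaw (univ : Set ℂ) δ).map
        (QuadConfig.translate (((δ / 2 : ℝ) : ℂ) * (1 + Complex.I))) : FiniteMeasure _)
    μδ.real {S | {i | Q i ∈ S} ∈ A} ≤ νδ.real {S | {i | Qt i ∉ S} ∈ A} +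
        ∑ i, ((1 - νδ.real (QuadConfig.crossedEvent (Qt i))) - μδ.real (QuadConfig.crossedEvent (Q i))) ∧
      νδ.real {S | {i | Qt i ∉ S} ∈ A} ≤ μδ.real {S | {i | Q i ∈ S} ∈ A} +
        ∑ i, ((1 - νδ.real (QuadConfig.crossedEvent (Qt i))) - μδ.real (QuadConfig.crossedEvent (Q i))) := by
  intro μδ νδ
  set v : ℂ := ((δ / 2 : ℝ) : ℂ) * (1 + Complex.I) with hv
  set P : Measure (BondConfig (Site 2)) := bondPercolation (zdGraph 2) half with hP
  set f : BondConfig (Site 2) → QuadConfig (univ : Set ℂ) := z2QuadConfig (univ : Set ℂ) δ with hf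
  set g : BondConfig (Site 2) → QuadConfig (univ : Set ℂ) :=
    QuadConfig.translate v ∘ z2QuadConfig (univ : Set ℂ) δ ∘ dualConfig with hg
  have hfm : Measurable f := measurable_z2QuadConfig isOpen_univ hδ
  have hgm : Measurable g :=
    (QuadConfig.measurable_translate v).comp (hfm.comp measurable_dualConfig)
  -- the events of the coupling
  set C : Fin n → Set (BondConfig (Site 2)) := fun i => f ⁻¹' QuadConfig.crossedEvent (Q i) with hC
  set D : Fin n → Set (BondConfig (Site 2)) := fun i => (g ⁻¹' QuadConfig.crossedEvent (Qt i))ᶜ with hD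
  have hCm : ∀ i, MeasurableSet (C i) := fun i => hfm (QuadConfig.measurableSet_crossedEvent _)
  have hCD : ∀ i, C i ⊆ D i := fun i ω hω => hexcl ω i hω
  obtain ⟨h₁, h₂⟩ := measureReal_pattern_le_of_subset P hCm hCD A
  -- identification of the four kinds of probabilities with `μδ`, `νδ`
  have hX : P.real {ω | {i | ω ∈ C i} ∈ A} = μδ.real {S | {i | Q i ∈ S} ∈ A} := by
    simp only [measureReal_def]
    rw [z2QuadLaw_apply isOpen_univ hδ (measurableSet_pattern Q A)]
    rfl
  have hY : P.real {ω | {i | ω ∈ D i} ∈ A} = νδ.real {S | {i | Qt i ∉ S} ∈ A} := by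
    simp only [measureReal_def]
    rw [setOf_pattern_not_mem_eq, ← prob_dual_translate_eq hδ v (measurableSet_pattern Qt _)]
    rfl
  have hCi : ∀ i, P.real (C i) = μδ.real (QuadConfig.crossedEvent (Q i)) := fun i => by
    simp only [measureReal_def]
    rw [z2QuadLaw_apply isOpen_univ hδ (QuadConfig.measurableSet_crossedEvent _)]
  have hDi : ∀ i, P.real (D i) = 1 - νδ.real (QuadConfig.crossedEvent (Qt i)) := fun i => by
    have hgi : MeasurableSet (g ⁻¹' QuadConfig.crossedEvent (Qt i)) :=
      hgm (QuadConfig.measurableSet_crossedEvent _)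
    rw [show D i = (g ⁻¹' QuadConfig.crossedEvent (Qt i))ᶜ from rfl, measureReal_compl hgi,
      probReal_univ]
    congr 1
    simp only [measureReal_def]
    rw [← prob_dual_translate_eq hδ v (QuadConfig.measurableSet_crossedEvent (Qt i))]
  simp only [hX, hY, hCi, hDi] at h₁ h₂
  exact ⟨h₁, h₂⟩

/-! ### The chart transpose of a charted quad -/

/-- Every quad of the plane is `rectQuad H 1 1` for some plane homeomorphism `H`
(`Quad.exists_homeomorph_extend`, Schoenflies). -/
theorem exists_eq_rectQuad (P : Quad (univ : Set ℂ)) :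
    ∃ H : ℂ ≃ₜ ℂ, P = Quad.rectQuad H 1 1 one_pos one_pos (fun _ => mem_univ _) := by
  obtain ⟨H, hH⟩ := P.exists_homeomorph_extend
  exact ⟨H, Quad.ext fun p => by rw [Quad.rectQuad_apply, Quad.rectMap_one_one, hH]⟩

/-- **The chart transpose has the carrier and the advanced sides**: for `Q = rectQuad H 1 1` and
`Q† = rectQuad (rotI.trans H) 1 1`, `[Q†] = [Q]`, `∂₀Q† = ∂₁Q`, `∂₁Q† = ∂₂Q`, `∂₂Q† = ∂₃Q`,
`∂₃Q† = ∂₀Q`. -/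
theorem rectQuad_rot_sides (H : ℂ ≃ₜ ℂ) :
    (Quad.rectQuad ((Homeomorph.mulLeft₀ Complex.I Complex.I_ne_zero).trans H) 1 1 one_pos one_pos
          (fun _ => mem_univ _)).carrier =
        (Quad.rectQuad H 1 1 one_pos one_pos (fun _ => mem_univ _)).carrier ∧
      (Quad.rectQuad ((Homeomorph.mulLeft₀ Complex.I Complex.I_ne_zero).trans H) 1 1 one_pos one_pos
          (fun _ => mem_univ _)).side 0 =
        (Quad.rectQuad H 1 1 one_pos one_pos (fun _ => mem_univ _)).side 1 ∧
      (Quad.rectQuad ((Homeomorph.mulLeft₀ Complex.I Complex.I_ne_zero).trans H) 1 1 one_pos one_pos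
          (fun _ => mem_univ _)).side 1 =
        (Quad.rectQuad H 1 1 one_pos one_pos (fun _ => mem_univ _)).side 2 ∧
      (Quad.rectQuad ((Homeomorph.mulLeft₀ Complex.I Complex.I_ne_zero).trans H) 1 1 one_pos one_pos
          (fun _ => mem_univ _)).side 2 =
        (Quad.rectQuad H 1 1 one_pos one_pos (fun _ => mem_univ _)).side 3 ∧
      (Quad.rectQuad ((Homeomorph.mulLeft₀ Complex.I Complex.I_ne_zero).trans H) 1 1 one_pos one_pos
          (fun _ => mem_univ _)).side 3 =
        (Quad.rectQuad H 1 1 one_pos one_pos (fun _ => mem_univ _)).side 0 := by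
  refine ⟨?_, ?_, ?_, ?_, ?_⟩
  · rw [carrier_rq_rot, carrier_rq]
  · rw [side_zero_rq_rot, side_one_rq]
  · rw [side_one_rq_rot, side_two_rq]
  · rw [side_two_rq_rot, side_three_rq]
  · rw [side_three_rq_rot, side_zero_rq]

/-! ### The assembly -/

/-- **S3e — `stub_selfDualMarginals_of`: exclusion (S3a), the `≥` half of one-quad duality (S3b) and
the side-dependence of crossing events (S3d) imply the exact self-duality of the finite-dimensional
crossing marginals of every `μ ∈ Λ` (the registered stub `stub_selfDualMarginals`, clause (D) of the
crux `Z2LimitsSymmetric`).**  See the module docstring for the coupling argument. -/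
theorem stub_selfDualMarginals_of : open Literature.Probability.Percolation.QuadCrossing in (∀ (δ : ℝ), 0 < δ → ∀ (ω : Literature.Probability.Percolation.BondConfig (Literature.Probability.LatticeModels.Site 2)) (Q Qt : Quad (Set.univ : Set ℂ)), Qt.carrier = Q.carrier → Qt.side 0 = Q.side 1 → Qt.side 2 = Q.side 3 → Q ∈ Literature.Probability.Percolation.z2QuadConfig (Set.univ : Set ℂ) δ ω → Qt ∉ QuadConfig.translate (((δ / 2 : ℝ) : ℂ) * (1 + Complex.I)) (Literature.Probability.Percolation.z2QuadConfig (Set.univ : Set ℂ) δ (Literature.Probability.Percolation.dualConfig ω))) → (∀ μ ∈ Literature.Probability.Percolation.QuadCrossing.subseqQuadLimits (Set.univ : Set ℂ), ∀ H : ℂ ≃ₜ ℂ, (1 : ENNReal) ≤ ((μ : MeasureTheory.FiniteMeasure (QuadConfig (Set.univ : Set ℂ))) : MeasureTheory.Measure (QuadConfig (Set.univ : Set ℂ))) (QuadConfig.crossedEvent (Quad.rectQuad H 1 1 one_pos one_pos (fun _ => Set.mem_univ _))) + ((μ : MeasureTheory.FiniteMeasure (QuadConfig (Set.univ : Set ℂ)))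 : MeasureTheory.Measure (QuadConfig (Set.univ : Set ℂ))) (QuadConfig.crossedEvent (Quad.rectQuad ((Homeomorph.mulLeft₀ Complex.I Complex.I_ne_zero).trans H) 1 1 one_pos one_pos (fun _ => Set.mem_univ _)))) → (∀ (P P' : Quad (Set.univ : Set ℂ)), P'.carrier = P.carrier → P'.side 0 = P.side 0 → P'.side 1 = P.side 1 → P'.side 2 = P.side 2 → P'.side 3 = P.side 3 → QuadConfig.crossedEvent P' = QuadConfig.crossedEvent P) → ∀ μ ∈ subseqQuadLimits (Set.univ : Set ℂ), ∀ (n : ℕ) (Q Qt : Fin n → Quad (Set.univ : Set ℂ)), (∀ i, (Qt i).carrier = (Q i).carrier ∧ (Qt i).side 0 = (Q i).side 1 ∧ (Qt i).side 1 = (Q i).side 2 ∧ (Qt i).side 2 = (Q i).side 3 ∧ (Qt i).side 3 = (Q i).side 0) → ∀ A : Set (Set (Fin n)), ((μ : MeasureTheory.FiniteMeasure (QuadConfig (Set.univ : Set ℂ))) : MeasureTheory.Measure (QuadConfig (Set.univ : Set ℂ))) {S | {i | Q i ∈ S} ∈ A} = ((μ : MeasureTheory.FiniteMeasure (QuadConfig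 (Set.univ : Set ℂ))) : MeasureTheory.Measure (QuadConfig (Set.univ : Set ℂ))) {S | {i | Qt i ∉ S} ∈ A} := by
  intro hexcl hge hsides μ hμ n Q Qt hrel A
  have hμ' : IsSubseqQuadLimit univ μ := hμ
  -- (1) the limit inequality `1 ≤ μ ⊞_{Q i} + μ ⊞_{Qt i}` for every `i` (S3b + S3d)
  have hdual : ∀ i, 1 ≤ (μ : Measure (QuadConfig (univ : Set ℂ))).real (QuadConfig.crossedEvent (Q i)) +
      (μ : Measure (QuadConfig (univ : Set ℂ))).real (QuadConfig.crossedEvent (Qt i)) := by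
    intro i
    obtain ⟨H, hH⟩ := exists_eq_rectQuad (Q i)
    obtain ⟨hcar, h0, h1, h2, h3⟩ := rectQuad_rot_sides H
    obtain ⟨hcar', h0', h1', h2', h3'⟩ := hrel i
    have heq : QuadConfig.crossedEvent (Qt i) = QuadConfig.crossedEvent
        (Quad.rectQuad ((Homeomorph.mulLeft₀ Complex.I Complex.I_ne_zero).trans H) 1 1 one_pos one_pos
          (fun _ => mem_univ _)) := by
      refine hsides _ _ ?_ ?_ ?_ ?_ ?_
      · rw [hcar', hH, hcar]
      · rw [h0', hH, h0]
      · rw [h1', hH, h1]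
      · rw [h2', hH, h2]
      · rw [h3', hH, h3]
    have h := hge μ hμ H
    rw [← hH, ← heq] at h
    have hfin : (μ : Measure (QuadConfig (univ : Set ℂ))) (QuadConfig.crossedEvent (Q i)) +
        (μ : Measure (QuadConfig (univ : Set ℂ))) (QuadConfig.crossedEvent (Qt i)) ≠ ∞ :=
      ENNReal.add_ne_top.2 ⟨measure_ne_top _ _, measure_ne_top _ _⟩
    have h' := ENNReal.toReal_mono hfin h
    rwa [ENNReal.toReal_one, ENNReal.toReal_add (measure_ne_top _ _) (measure_ne_top _ _)] at h'
  -- (2) the defining meshes and the two approximating sequences of laws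
  obtain ⟨δs, hpos, hδ0, hlim⟩ := (isSubseqQuadLimit_iff univ μ).mp hμ'
  set v : ℕ → ℂ := fun k => ((δs k / 2 : ℝ) : ℂ) * (1 + Complex.I) with hv
  have hv0 : Tendsto v atTop (𝓝 0) := by
    have h1 : Tendsto (fun k => ((δs k / 2 : ℝ) : ℂ)) atTop (𝓝 ((0 : ℝ) : ℂ)) :=
      (Complex.continuous_ofReal.tendsto 0).comp (by simpa using hδ0.div_const 2)
    have h2 := h1.mul_const (1 + Complex.I)
    rw [Complex.ofReal_zero, zero_mul] at h2
    exact h2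
  set νs : ℕ → FiniteMeasure (QuadConfig (univ : Set ℂ)) :=
    fun k => (z2QuadLaw (univ : Set ℂ) (δs k)).map (QuadConfig.translate (v k)) with hνs
  have hlimν : Tendsto νs atTop (𝓝 μ) :=
    Summit.CriticalPhenomena.CardyFormulaZ2.Cruxes.LagHandOff.CrosscutDictionary.tendsto_map_translate_of_tendsto
      hlim (fun k => isProbabilityMeasure_z2QuadLaw_of_pos isOpen_univ (hpos k)) hv0
  -- (3) the real sequences and their limits
  set E : Set (QuadConfig (univ : Set ℂ)) := {S | {i | Q i ∈ S} ∈ A} with hE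
  set F : Set (QuadConfig (univ : Set ℂ)) := {S | {i | Qt i ∉ S} ∈ A} with hF
  have hFeq : F = {S | {i | Qt i ∈ S} ∈ compl ⁻¹' A} := setOf_pattern_not_mem_eq Qt A
  have tE : Tendsto (fun k => (z2QuadLaw (univ : Set ℂ) (δs k) : Measure _).real E) atTop
      (𝓝 ((μ : Measure (QuadConfig (univ : Set ℂ))).real E)) :=
    (ENNReal.tendsto_toReal (measure_ne_top _ _)).comp (tendsto_measure_pattern Q A hμ' hlim)
  have tF : Tendsto (fun k => (νs k : Measure _).real F) atTop
      (𝓝 ((μ : Measure (QuadConfig (univ : Set ℂ))).real F)) := by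
    rw [hFeq]
    exact (ENNReal.tendsto_toReal (measure_ne_top _ _)).comp (tendsto_measure_pattern Qt _ hμ' hlimν)
  have tC : ∀ i, Tendsto (fun k => (z2QuadLaw (univ : Set ℂ) (δs k) : Measure _).real
      (QuadConfig.crossedEvent (Q i))) atTop
      (𝓝 ((μ : Measure (QuadConfig (univ : Set ℂ))).real (QuadConfig.crossedEvent (Q i)))) := fun i =>
    (ENNReal.tendsto_toReal (measure_ne_top _ _)).comp (tendsto_measure_crossedEvent (Q i) hμ' hlim)
  have tD : ∀ i, Tendsto (fun k => (νs k : Measure _).real (QuadConfig.crossedEvent (Qt i))) atTop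
      (𝓝 ((μ : Measure (QuadConfig (univ : Set ℂ))).real (QuadConfig.crossedEvent (Qt i)))) := fun i =>
    (ENNReal.tendsto_toReal (measure_ne_top _ _)).comp (tendsto_measure_crossedEvent (Qt i) hμ' hlimν)
  -- the error term and its limit
  have tR : Tendsto (fun k => ∑ i, ((1 - (νs k : Measure _).real (QuadConfig.crossedEvent (Qt i))) -
      (z2QuadLaw (univ : Set ℂ) (δs k) : Measure _).real (QuadConfig.crossedEvent (Q i)))) atTop
      (𝓝 (∑ i, ((1 - (μ : Measure (QuadConfig (univ : Set ℂ))).real (QuadConfig.crossedEvent (Qt i))) -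
        (μ : Measure (QuadConfig (univ : Set ℂ))).real (QuadConfig.crossedEvent (Q i))))) :=
    tendsto_finsetSum _ fun i _ => ((tendsto_const_nhds.sub (tD i)).sub (tC i))
  have hR : ∑ i, ((1 - (μ : Measure (QuadConfig (univ : Set ℂ))).real (QuadConfig.crossedEvent (Qt i))) -
      (μ : Measure (QuadConfig (univ : Set ℂ))).real (QuadConfig.crossedEvent (Q i))) ≤ 0 :=
    Finset.sum_nonpos fun i _ => by linarith [hdual i]
  -- (4) the coupling inequality at each mesh and the limit
  have hk : ∀ k, (z2QuadLaw (univ : Set ℂ) (δs k) : Measure _).real E ≤ (νs k : Measure _).real F +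
        ∑ i, ((1 - (νs k : Measure _).real (QuadConfig.crossedEvent (Qt i))) -
          (z2QuadLaw (univ : Set ℂ) (δs k) : Measure _).real (QuadConfig.crossedEvent (Q i))) ∧
      (νs k : Measure _).real F ≤ (z2QuadLaw (univ : Set ℂ) (δs k) : Measure _).real E +
        ∑ i, ((1 - (νs k : Measure _).real (QuadConfig.crossedEvent (Qt i))) -
          (z2QuadLaw (univ : Set ℂ) (δs k) : Measure _).real (QuadConfig.crossedEvent (Q i))) := fun k =>
    coupling_le (hpos k) Q Qt (fun ω i hQ => hexcl (δs k) (hpos k) ω (Q i) (Qt i) (hrel i).1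
      (hrel i).2.1 (hrel i).2.2.2.1 hQ) A
  have hle₁ : (μ : Measure (QuadConfig (univ : Set ℂ))).real E ≤ (μ : Measure (QuadConfig (univ : Set ℂ))).real F +
      ∑ i, ((1 - (μ : Measure (QuadConfig (univ : Set ℂ))).real (QuadConfig.crossedEvent (Qt i))) -
        (μ : Measure (QuadConfig (univ : Set ℂ))).real (QuadConfig.crossedEvent (Q i))) :=
    le_of_tendsto_of_tendsto' tE (tF.add tR) fun k => (hk k).1
  have hle₂ : (μ : Measure (QuadConfig (univ : Set ℂ))).real F ≤ (μ : Measure (QuadConfig (univ : Set ℂ))).real E +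
      ∑ i, ((1 - (μ : Measure (QuadConfig (univ : Set ℂ))).real (QuadConfig.crossedEvent (Qt i))) -
        (μ : Measure (QuadConfig (univ : Set ℂ))).real (QuadConfig.crossedEvent (Q i))) :=
    le_of_tendsto_of_tendsto' tF (tE.add tR) fun k => (hk k).2
  have hreal : (μ : Measure (QuadConfig (univ : Set ℂ))).real E = (μ : Measure (QuadConfig (univ : Set ℂ))).real F := by
    linarith
  exact (measureReal_eq_measureReal_iff (measure_ne_top _ _) (measure_ne_top _ _)).1 hreal

end Summit.CriticalPhenomena.CardyFormulaZ2.Cruxes.Z2LimitsSymmetric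

end
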